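import Summits.CriticalPhenomena.PercolationContinuityZ3.Theorems.Transplant.FKConnectivityAllQAntipodalMajThetaEars
import Summits.CriticalPhenomena.PercolationContinuityZ3.Theorems.Transplant.FKConnectivityAllQAntipodalOrAttPlus
import HarnessLib

/-!
# Connectivity correlation inequalities for `φ_{w,q}`, every `q > 0` — file 49b: THE THETA BRIDGE — the weighted antipodal form of
# `maj₃` on a host with two ears, regrouped by the states of the two free ear edges

Support file (`--supports stmt-CriticalPhenomena-4575`), FK sub-lane `prim-bschramm-fk-2` (gen 23); builds on p205010 (kernel theorem,
internal audit signed; external expert review pending).  No definitions, no named facts, no sorries; standard axioms.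

Host: `B` (edges among old vertices, the vertices `c₁ ≠ c₂` fresh) plus two ears `p₁ – c₁ – q₁`, `p₂ – c₂ – q₂` presenting the pair
`{a, b}`; special edges `x = p₁c₁`, `y = p₂c₂` and `z` (inside `B`); free ear tails `f = c₁q₁`, `g = c₂q₂`; cell `(N ∪ {z} ∪ ears, C)`.
With `W` the level weight (shifted so that the host exponent is `A + cyc − 4`, `A = apExpC (N ∪ {z}) C γ` the exponent of the `B`-part,
`ι₁, ι₂` the indicators of `a ↔ b` in the two members of the pair, `σ = −1` iff `z ∈ γ`), the weighted antipodal form of `maj₃(x,y,z)`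
against `g` equals `−2 ∑_γ [g₁₁ Φ₁₁ + g₀₀ Φ₀₀ + (g₁₀ + g₀₁) Φ₁₀](γ)`, `g_{b_f b_g}(γ) = g(γ ∪ C ∪ ears tails present)`,
`Φ₁₁ = −W(A+1+ι₁) + 2σW(A+ι₁) + W(A)`, `Φ₀₀ = W(A+1+ι₂) + 2σW(A+ι₂) − W(A)`, `Φ₁₀ = −W(A+ι₁) + σ(W(A+ι₁+ι₂) + W(A)) + W(A+ι₂)`
(memo `bschramm/FROM-fk-2-g23-THETA.md` §2; verified numerically before typing).  The sixteen ear states are evaluated with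
`FK.two_ears_counts` on both members of the complementary pair.
[cite: Grimmett2006, §1.4 eq. (1.20) (p. 15); §3.8 (pp. 61–62)]
-/

noncomputable section

namespace Summit.CriticalPhenomena.PercolationContinuityZ3.Theorems

namespace FK

open SimpleGraph Literature.Probability.LatticeModels Literature.Probability.Percolation
open scoped Classical

variable {V : Type*}

section Bridge

variable [Fintype V]

/-- **THE THETA BRIDGE.**  The weighted antipodal form (weight `n ↦ W(n+4)`) of `maj₃(p₁c₁, p₂c₂, z)` against `g` over the cell
`(N ∪ {z} ∪ {p₁c₁, c₁q₁, p₂c₂, c₂q₂}, C)` of the two-ear host, regrouped by the states of the ear tails `c₁q₁, c₂q₂` into the three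
functionals `Φ₁₁, Φ₀₀, Φ₁₀` of the `B`-part (see the file header). [cite: Grimmett2006, §1.4 eq. (1.20) (p. 15); §3.8 (pp. 61–62)] -/
theorem apPsiCW_maj3_theta_eq (W : ℕ → ℝ) {N C : Finset (Sym2 V)} {z : Sym2 V} {a b c₁ c₂ p₁ q₁ p₂ q₂ : V}
    (hab : a ≠ b) (hpq₁ : s(p₁, q₁) = s(a, b)) (hpq₂ : s(p₂, q₂) = s(a, b))
    (hac₁ : a ≠ c₁) (hbc₁ : b ≠ c₁) (hac₂ : a ≠ c₂) (hbc₂ : b ≠ c₂) (hc₁₂ : c₁ ≠ c₂)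
    (hc₁ : ∀ e ∈ insert z (N ∪ C), c₁ ∉ e) (hc₂ : ∀ e ∈ insert z (N ∪ C), c₂ ∉ e)
    (hzC : z ∉ C)
    {g : Finset (Sym2 V) → ℝ} (hgx : ∀ A, g (insert s(p₁, c₁) A) = g A) (hgy : ∀ A, g (insert s(p₂, c₂) A) = g A) :
    ∑ γ ∈ (insert s(p₁, c₁) (insert s(c₁, q₁) (insert s(p₂, c₂) (insert s(c₂, q₂) (insert z N))))).powerset,
        W (apExpC (insert s(p₁, c₁) (insert s(c₁, q₁) (insert s(p₂, c₂) (insert s(c₂, q₂) (insert z N))))) C γ + 4) *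
          ((((fun X : Finset (Sym2 V) =>
                if (s(p₁, c₁) ∈ X ∧ s(p₂, c₂) ∈ X) ∨ (s(p₁, c₁) ∈ X ∧ z ∈ X) ∨ (s(p₂, c₂) ∈ X ∧ z ∈ X) then (1 : ℝ) else 0) (γ ∪ C)) -
              ((fun X : Finset (Sym2 V) =>
                if (s(p₁, c₁) ∈ X ∧ s(p₂, c₂) ∈ X) ∨ (s(p₁, c₁) ∈ X ∧ z ∈ X) ∨ (s(p₂, c₂) ∈ X ∧ z ∈ X) then (1 : ℝ) else 0)
                ((insert s(p₁, c₁) (insert s(c₁, q₁) (insert s(p₂, c₂) (insert s(c₂, q₂) (insert z N))))) \ γ ∪ C))) *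
            (g (γ ∪ C) - g ((insert s(p₁, c₁) (insert s(c₁, q₁) (insert s(p₂, c₂) (insert s(c₂, q₂) (insert z N))))) \ γ ∪ C))) =
      -2 * ∑ γ ∈ (insert z N).powerset,
        (g (insert s(c₁, q₁) (insert s(c₂, q₂) (γ ∪ C))) *
            (-W (apExpC (insert z N) C γ + 1 + (if (openGraph (↑(γ ∪ C) : BondConfig V)).Reachable a b then 1 else 0)) +
              2 * (if z ∈ γ then (-1 : ℝ) else 1) *
                W (apExpC (insert z N) C γ + (if (openGraph (↑(γ ∪ C) : BondConfig V)).Reachable a b then 1 else 0)) +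
              W (apExpC (insert z N) C γ)) +
          g (γ ∪ C) *
            (W (apExpC (insert z N) C γ + 1 + (if (openGraph (↑(insert z N \ γ ∪ C) : BondConfig V)).Reachable a b then 1 else 0)) +
              2 * (if z ∈ γ then (-1 : ℝ) else 1) *
                W (apExpC (insert z N) C γ + (if (openGraph (↑(insert z N \ γ ∪ C) : BondConfig V)).Reachable a b then 1 else 0)) -
              W (apExpC (insert z N) C γ)) +
          (g (insert s(c₁, q₁) (γ ∪ C)) + g (insert s(c₂, q₂) (γ ∪ C))) *
            (-W (apExpC (insert z N) C γ + (if (openGraph (↑(γ ∪ C) : BondConfig V)).Reachable a b then 1 else 0)) +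
              (if z ∈ γ then (-1 : ℝ) else 1) *
                (W (apExpC (insert z N) C γ + (if (openGraph (↑(γ ∪ C) : BondConfig V)).Reachable a b then 1 else 0) +
                    (if (openGraph (↑(insert z N \ γ ∪ C) : BondConfig V)).Reachable a b then 1 else 0)) +
                  W (apExpC (insert z N) C γ)) +
              W (apExpC (insert z N) C γ + (if (openGraph (↑(insert z N \ γ ∪ C) : BondConfig V)).Reachable a b then 1 else 0)))) := by
  -- elementary facts
  obtain ⟨hp₁c₁, hq₁c₁⟩ := ne_of_sym2_eq_of_ne hpq₁ hac₁ hbc₁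
  obtain ⟨hp₁c₂, hq₁c₂⟩ := ne_of_sym2_eq_of_ne hpq₁ hac₂ hbc₂
  obtain ⟨hp₂c₁, hq₂c₁⟩ := ne_of_sym2_eq_of_ne hpq₂ hac₁ hbc₁
  obtain ⟨hp₂c₂, hq₂c₂⟩ := ne_of_sym2_eq_of_ne hpq₂ hac₂ hbc₂
  have hp₁q₁ : p₁ ≠ q₁ := by
    rcases Sym2.eq_iff.1 hpq₁ with ⟨h1, h2⟩ | ⟨h1, h2⟩
    · rw [h1, h2]; exact hab
    · rw [h1, h2]; exact hab.symm
  have hp₂q₂ : p₂ ≠ q₂ := by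
    rcases Sym2.eq_iff.1 hpq₂ with ⟨h1, h2⟩ | ⟨h1, h2⟩
    · rw [h1, h2]; exact hab
    · rw [h1, h2]; exact hab.symm
  -- the four ear edges are pairwise distinct
  have hxf : s(p₁, c₁) ≠ s(c₁, q₁) := by
    intro h; rw [Sym2.eq_iff] at h
    rcases h with ⟨h1, _⟩ | ⟨h1, _⟩
    · exact hp₁c₁ h1
    · exact hp₁q₁ h1
  have hxy : s(p₁, c₁) ≠ s(p₂, c₂) := by
    intro h; rw [Sym2.eq_iff] at h
    rcases h with ⟨_, h2⟩ | ⟨h1, _⟩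
    · exact hc₁₂ h2
    · exact hp₁c₂ h1
  have hxg : s(p₁, c₁) ≠ s(c₂, q₂) := by
    intro h; rw [Sym2.eq_iff] at h
    rcases h with ⟨h1, _⟩ | ⟨_, h2⟩
    · exact hp₁c₂ h1
    · exact hc₁₂ h2
  have hfy : s(c₁, q₁) ≠ s(p₂, c₂) := by
    intro h; rw [Sym2.eq_iff] at h
    rcases h with ⟨h1, _⟩ | ⟨h1, _⟩
    · exact hp₂c₁ h1.symm
    · exact hc₁₂ h1
  have hfg : s(c₁, q₁) ≠ s(c₂, q₂) := by
    intro h; rw [Sym2.eq_iff] at h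
    rcases h with ⟨h1, _⟩ | ⟨_, h2⟩
    · exact hc₁₂ h1
    · exact hq₁c₂ h2
  have hyg : s(p₂, c₂) ≠ s(c₂, q₂) := by
    intro h; rw [Sym2.eq_iff] at h
    rcases h with ⟨h1, _⟩ | ⟨h1, _⟩
    · exact hp₂c₂ h1
    · exact hp₂q₂ h1
  -- the ear edges avoid `insert z (N ∪ C)`
  have hxO : s(p₁, c₁) ∉ insert z (N ∪ C) := fun h => hc₁ _ h (Sym2.mem_mk_right _ _)
  have hfO : s(c₁, q₁) ∉ insert z (N ∪ C) := fun h => hc₁ _ h (Sym2.mem_mk_left _ _)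
  have hyO : s(p₂, c₂) ∉ insert z (N ∪ C) := fun h => hc₂ _ h (Sym2.mem_mk_right _ _)
  have hgO : s(c₂, q₂) ∉ insert z (N ∪ C) := fun h => hc₂ _ h (Sym2.mem_mk_left _ _)
  have hzx : z ≠ s(p₁, c₁) := fun h => hxO (h ▸ Finset.mem_insert_self _ _)
  have hzf : z ≠ s(c₁, q₁) := fun h => hfO (h ▸ Finset.mem_insert_self _ _)
  have hzy : z ≠ s(p₂, c₂) := fun h => hyO (h ▸ Finset.mem_insert_self _ _)
  have hzg : z ≠ s(c₂, q₂) := fun h => hgO (h ▸ Finset.mem_insert_self _ _)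
  have hxN : s(p₁, c₁) ∉ N := fun h => hxO (Finset.mem_insert_of_mem (Finset.mem_union_left _ h))
  have hfN : s(c₁, q₁) ∉ N := fun h => hfO (Finset.mem_insert_of_mem (Finset.mem_union_left _ h))
  have hyN : s(p₂, c₂) ∉ N := fun h => hyO (Finset.mem_insert_of_mem (Finset.mem_union_left _ h))
  have hgN : s(c₂, q₂) ∉ N := fun h => hgO (Finset.mem_insert_of_mem (Finset.mem_union_left _ h))
  have hxC : s(p₁, c₁) ∉ C := fun h => hxO (Finset.mem_insert_of_mem (Finset.mem_union_right _ h))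
  have hfC : s(c₁, q₁) ∉ C := fun h => hfO (Finset.mem_insert_of_mem (Finset.mem_union_right _ h))
  have hyC : s(p₂, c₂) ∉ C := fun h => hyO (Finset.mem_insert_of_mem (Finset.mem_union_right _ h))
  have hgC : s(c₂, q₂) ∉ C := fun h => hgO (Finset.mem_insert_of_mem (Finset.mem_union_right _ h))
  have hgM : s(c₂, q₂) ∉ insert z N := by rw [Finset.mem_insert, not_or]; exact ⟨hzg.symm, hgN⟩
  have hyM : s(p₂, c₂) ∉ insert s(c₂, q₂) (insert z N) := by
    rw [Finset.mem_insert, Finset.mem_insert, not_or, not_or]; exact ⟨hyg, hzy.symm, hyN⟩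
  have hfM : s(c₁, q₁) ∉ insert s(p₂, c₂) (insert s(c₂, q₂) (insert z N)) := by
    rw [Finset.mem_insert, Finset.mem_insert, Finset.mem_insert, not_or, not_or, not_or]; exact ⟨hfy, hfg, hzf.symm, hfN⟩
  have hxM : s(p₁, c₁) ∉ insert s(c₁, q₁) (insert s(p₂, c₂) (insert s(c₂, q₂) (insert z N))) := by
    rw [Finset.mem_insert, Finset.mem_insert, Finset.mem_insert, Finset.mem_insert, not_or, not_or, not_or, not_or]
    exact ⟨hxf, hxy, hxg, hzx.symm, hxN⟩
  have hgy' : ∀ A : Finset (Sym2 V), g (insert s(c₁, q₁) (insert s(p₂, c₂) A)) = g (insert s(c₁, q₁) A) := fun A => by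
    rw [Finset.insert_comm, hgy]
  -- half-sum form and expansion over the four ear edges
  rw [apPsiCW_half_eq (fun n => W (n + 4)) (insert s(p₁, c₁) (insert s(c₁, q₁) (insert s(p₂, c₂) (insert s(c₂, q₂) (insert z N))))) C
    (fun X : Finset (Sym2 V) => if s(p₁, c₁) ∈ X ∧ s(p₂, c₂) ∈ X ∨ s(p₁, c₁) ∈ X ∧ z ∈ X ∨ s(p₂, c₂) ∈ X ∧ z ∈ X then (1 : ℝ) else 0) g]
  simp only [Finset.sum_powerset_insert hxM, Finset.sum_powerset_insert hfM, Finset.sum_powerset_insert hyM,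
    Finset.sum_powerset_insert hgM, ← Finset.sum_add_distrib, Finset.mul_sum]
  refine Finset.sum_congr rfl fun γ hγ => ?_
  rw [Finset.mem_powerset] at hγ
  have hγO : γ ∪ C ⊆ insert z (N ∪ C) :=
    Finset.union_subset (hγ.trans (Finset.insert_subset_insert _ Finset.subset_union_left))
      ((Finset.subset_union_right).trans (Finset.subset_insert _ _))
  have hδO : insert z N \ γ ∪ C ⊆ insert z (N ∪ C) :=
    Finset.union_subset (Finset.sdiff_subset.trans (Finset.insert_subset_insert _ Finset.subset_union_left))
      ((Finset.subset_union_right).trans (Finset.subset_insert _ _))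
  have hxγ : s(p₁, c₁) ∉ γ := fun h => hxO (hγO (Finset.mem_union_left _ h))
  have hfγ : s(c₁, q₁) ∉ γ := fun h => hfO (hγO (Finset.mem_union_left _ h))
  have hyγ : s(p₂, c₂) ∉ γ := fun h => hyO (hγO (Finset.mem_union_left _ h))
  have hgγ : s(c₂, q₂) ∉ γ := fun h => hgO (hγO (Finset.mem_union_left _ h))
  -- cluster counts of the sixteen ear states over each member of the pair
  obtain ⟨a1, a2, a3, a4, a5, a6, a7, a8, a9, a10, a11, a12, a13, a14, a15⟩ := two_ears_counts (R := γ ∪ C) hpq₁ hpq₂ hac₁ hbc₁ hac₂ hbc₂ hc₁₂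
    (fun e he => hc₁ e (hγO he)) (fun e he => hc₂ e (hγO he))
  obtain ⟨b1, b2, b3, b4, b5, b6, b7, b8, b9, b10, b11, b12, b13, b14, b15⟩ := two_ears_counts (R := insert z N \ γ ∪ C) hpq₁ hpq₂ hac₁ hbc₁ hac₂ hbc₂ hc₁₂
    (fun e he => hc₁ e (hδO he)) (fun e he => hc₂ e (hδO he))
  simp only [apExpC, Finset.insert_sdiff_of_mem, Finset.insert_sdiff_of_notMem, Finset.sdiff_insert_of_notMem,
    Finset.mem_insert, Finset.mem_union, Finset.mem_sdiff, hxγ, hfγ, hyγ, hgγ, hxN, hfN, hyN, hgN, hxC, hyC, hzC,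
    hxf, hxy, hxg, hfy, hfg, hyg, hxy.symm, hfy.symm, hzx, hzf, hzy, hzg,
    hzx.symm, hzf.symm, hzy.symm, hzg.symm, Finset.insert_union, hgx, hgy, hgy',
    true_or, or_true, or_false, false_or,
    true_and, and_true, false_and, and_false, if_true, if_false, not_false_iff, or_self, and_self]
  by_cases hr₁ : (openGraph (↑(γ ∪ C) : BondConfig V)).Reachable a b <;>
    by_cases hr₂ : (openGraph (↑(insert z N \ γ ∪ C) : BondConfig V)).Reachable a b <;>
    simp only [hr₁, hr₂, if_true, if_false, add_zero] at a5 a10 a11 a12 a13 a14 a15 b5 b10 b11 b12 b13 b14 b15 ⊢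
  · have e0 : clusterCount (↑(γ ∪ C) : BondConfig V) ∅ + clusterCount (↑(insert s(p₁, c₁) (insert s(c₁, q₁) (insert s(p₂, c₂) (insert s(c₂, q₂) (insert z N \ γ ∪ C))))) : BondConfig V) ∅ + 4 =
        clusterCount (↑(γ ∪ C) : BondConfig V) ∅ + clusterCount (↑(insert z N \ γ ∪ C) : BondConfig V) ∅ + 1 + 1 := by clear * - b15; omega
    have e1 : clusterCount (↑(insert s(p₁, c₁) (γ ∪ C)) : BondConfig V) ∅ + clusterCount (↑(insert s(c₁, q₁) (insert s(p₂, c₂) (insert s(c₂, q₂) (insert z N \ γ ∪ C)))) : BondConfig V) ∅ + 4 =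
        clusterCount (↑(γ ∪ C) : BondConfig V) ∅ + clusterCount (↑(insert z N \ γ ∪ C) : BondConfig V) ∅ + 1 := by clear * - a1 b14; omega
    have e2 : clusterCount (↑(insert s(c₁, q₁) (γ ∪ C)) : BondConfig V) ∅ + clusterCount (↑(insert s(p₁, c₁) (insert s(p₂, c₂) (insert s(c₂, q₂) (insert z N \ γ ∪ C)))) : BondConfig V) ∅ + 4 =
        clusterCount (↑(γ ∪ C) : BondConfig V) ∅ + clusterCount (↑(insert z N \ γ ∪ C) : BondConfig V) ∅ + 1 := by clear * - a2 b13; omega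
    have e3 : clusterCount (↑(insert s(p₂, c₂) (γ ∪ C)) : BondConfig V) ∅ + clusterCount (↑(insert s(p₁, c₁) (insert s(c₁, q₁) (insert s(c₂, q₂) (insert z N \ γ ∪ C)))) : BondConfig V) ∅ + 4 =
        clusterCount (↑(γ ∪ C) : BondConfig V) ∅ + clusterCount (↑(insert z N \ γ ∪ C) : BondConfig V) ∅ + 1 := by clear * - a3 b12; omega
    have e4 : clusterCount (↑(insert s(c₂, q₂) (γ ∪ C)) : BondConfig V) ∅ + clusterCount (↑(insert s(p₁, c₁) (insert s(c₁, q₁) (insert s(p₂, c₂) (insert z N \ γ ∪ C)))) : BondConfig V) ∅ + 4 =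
        clusterCount (↑(γ ∪ C) : BondConfig V) ∅ + clusterCount (↑(insert z N \ γ ∪ C) : BondConfig V) ∅ + 1 := by clear * - a4 b11; omega
    have e5 : clusterCount (↑(insert s(p₁, c₁) (insert s(c₁, q₁) (γ ∪ C))) : BondConfig V) ∅ + clusterCount (↑(insert s(p₂, c₂) (insert s(c₂, q₂) (insert z N \ γ ∪ C))) : BondConfig V) ∅ + 4 =
        clusterCount (↑(γ ∪ C) : BondConfig V) ∅ + clusterCount (↑(insert z N \ γ ∪ C) : BondConfig V) ∅ + 1 + 1 := by clear * - a5 b10; omega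
    have e6 : clusterCount (↑(insert s(p₁, c₁) (insert s(p₂, c₂) (γ ∪ C))) : BondConfig V) ∅ + clusterCount (↑(insert s(c₁, q₁) (insert s(c₂, q₂) (insert z N \ γ ∪ C))) : BondConfig V) ∅ + 4 =
        clusterCount (↑(γ ∪ C) : BondConfig V) ∅ + clusterCount (↑(insert z N \ γ ∪ C) : BondConfig V) ∅ := by clear * - a6 b9; omega
    have e7 : clusterCount (↑(insert s(p₁, c₁) (insert s(c₂, q₂) (γ ∪ C))) : BondConfig V) ∅ + clusterCount (↑(insert s(c₁, q₁) (insert s(p₂, c₂) (insert z N \ γ ∪ C))) : BondConfig V) ∅ + 4 =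
        clusterCount (↑(γ ∪ C) : BondConfig V) ∅ + clusterCount (↑(insert z N \ γ ∪ C) : BondConfig V) ∅ := by clear * - a7 b8; omega
    have e8 : clusterCount (↑(insert s(c₁, q₁) (insert s(p₂, c₂) (γ ∪ C))) : BondConfig V) ∅ + clusterCount (↑(insert s(p₁, c₁) (insert s(c₂, q₂) (insert z N \ γ ∪ C))) : BondConfig V) ∅ + 4 =
        clusterCount (↑(γ ∪ C) : BondConfig V) ∅ + clusterCount (↑(insert z N \ γ ∪ C) : BondConfig V) ∅ := by clear * - a8 b7; omega
    have e9 : clusterCount (↑(insert s(c₁, q₁) (insert s(c₂, q₂) (γ ∪ C))) : BondConfig V) ∅ + clusterCount (↑(insert s(p₁, c₁) (insert s(p₂, c₂) (insert z N \ γ ∪ C))) : BondConfig V) ∅ + 4 =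
        clusterCount (↑(γ ∪ C) : BondConfig V) ∅ + clusterCount (↑(insert z N \ γ ∪ C) : BondConfig V) ∅ := by clear * - a9 b6; omega
    have e10 : clusterCount (↑(insert s(p₂, c₂) (insert s(c₂, q₂) (γ ∪ C))) : BondConfig V) ∅ + clusterCount (↑(insert s(p₁, c₁) (insert s(c₁, q₁) (insert z N \ γ ∪ C))) : BondConfig V) ∅ + 4 =
        clusterCount (↑(γ ∪ C) : BondConfig V) ∅ + clusterCount (↑(insert z N \ γ ∪ C) : BondConfig V) ∅ + 1 + 1 := by clear * - a10 b5; omega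
    have e11 : clusterCount (↑(insert s(p₁, c₁) (insert s(c₁, q₁) (insert s(p₂, c₂) (γ ∪ C)))) : BondConfig V) ∅ + clusterCount (↑(insert s(c₂, q₂) (insert z N \ γ ∪ C)) : BondConfig V) ∅ + 4 =
        clusterCount (↑(γ ∪ C) : BondConfig V) ∅ + clusterCount (↑(insert z N \ γ ∪ C) : BondConfig V) ∅ + 1 := by clear * - a11 b4; omega
    have e12 : clusterCount (↑(insert s(p₁, c₁) (insert s(c₁, q₁) (insert s(c₂, q₂) (γ ∪ C)))) : BondConfig V) ∅ + clusterCount (↑(insert s(p₂, c₂) (insert z N \ γ ∪ C)) : BondConfig V) ∅ + 4 =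
        clusterCount (↑(γ ∪ C) : BondConfig V) ∅ + clusterCount (↑(insert z N \ γ ∪ C) : BondConfig V) ∅ + 1 := by clear * - a12 b3; omega
    have e13 : clusterCount (↑(insert s(p₁, c₁) (insert s(p₂, c₂) (insert s(c₂, q₂) (γ ∪ C)))) : BondConfig V) ∅ + clusterCount (↑(insert s(c₁, q₁) (insert z N \ γ ∪ C)) : BondConfig V) ∅ + 4 =
        clusterCount (↑(γ ∪ C) : BondConfig V) ∅ + clusterCount (↑(insert z N \ γ ∪ C) : BondConfig V) ∅ + 1 := by clear * - a13 b2; omega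
    have e14 : clusterCount (↑(insert s(c₁, q₁) (insert s(p₂, c₂) (insert s(c₂, q₂) (γ ∪ C)))) : BondConfig V) ∅ + clusterCount (↑(insert s(p₁, c₁) (insert z N \ γ ∪ C)) : BondConfig V) ∅ + 4 =
        clusterCount (↑(γ ∪ C) : BondConfig V) ∅ + clusterCount (↑(insert z N \ γ ∪ C) : BondConfig V) ∅ + 1 := by clear * - a14 b1; omega
    have e15 : clusterCount (↑(insert s(p₁, c₁) (insert s(c₁, q₁) (insert s(p₂, c₂) (insert s(c₂, q₂) (γ ∪ C))))) : BondConfig V) ∅ + clusterCount (↑(insert z N \ γ ∪ C) : BondConfig V) ∅ + 4 =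
        clusterCount (↑(γ ∪ C) : BondConfig V) ∅ + clusterCount (↑(insert z N \ γ ∪ C) : BondConfig V) ∅ + 1 + 1 := by clear * - a15; omega
    rw [e0, e1, e2, e3, e4, e5, e6, e7, e8, e9, e10, e11, e12, e13, e14, e15]
    by_cases hz : z ∈ γ
    · simp only [hz, if_true, not_true, if_false]; ring
    · simp only [hz, if_false, not_false_iff, if_true]; ring
  · have e0 : clusterCount (↑(γ ∪ C) : BondConfig V) ∅ + clusterCount (↑(insert s(p₁, c₁) (insert s(c₁, q₁) (insert s(p₂, c₂) (insert s(c₂, q₂) (insert z N \ γ ∪ C))))) : BondConfig V) ∅ + 4 =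
        clusterCount (↑(γ ∪ C) : BondConfig V) ∅ + clusterCount (↑(insert z N \ γ ∪ C) : BondConfig V) ∅ + 1 := by clear * - b15; omega
    have e1 : clusterCount (↑(insert s(p₁, c₁) (γ ∪ C)) : BondConfig V) ∅ + clusterCount (↑(insert s(c₁, q₁) (insert s(p₂, c₂) (insert s(c₂, q₂) (insert z N \ γ ∪ C)))) : BondConfig V) ∅ + 4 =
        clusterCount (↑(γ ∪ C) : BondConfig V) ∅ + clusterCount (↑(insert z N \ γ ∪ C) : BondConfig V) ∅ := by clear * - a1 b14; omega
    have e2 : clusterCount (↑(insert s(c₁, q₁) (γ ∪ C)) : BondConfig V) ∅ + clusterCount (↑(insert s(p₁, c₁) (insert s(p₂, c₂) (insert s(c₂, q₂) (insert z N \ γ ∪ C)))) : BondConfig V) ∅ + 4 =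
        clusterCount (↑(γ ∪ C) : BondConfig V) ∅ + clusterCount (↑(insert z N \ γ ∪ C) : BondConfig V) ∅ := by clear * - a2 b13; omega
    have e3 : clusterCount (↑(insert s(p₂, c₂) (γ ∪ C)) : BondConfig V) ∅ + clusterCount (↑(insert s(p₁, c₁) (insert s(c₁, q₁) (insert s(c₂, q₂) (insert z N \ γ ∪ C)))) : BondConfig V) ∅ + 4 =
        clusterCount (↑(γ ∪ C) : BondConfig V) ∅ + clusterCount (↑(insert z N \ γ ∪ C) : BondConfig V) ∅ := by clear * - a3 b12; omega
    have e4 : clusterCount (↑(insert s(c₂, q₂) (γ ∪ C)) : BondConfig V) ∅ + clusterCount (↑(insert s(p₁, c₁) (insert s(c₁, q₁) (insert s(p₂, c₂) (insert z N \ γ ∪ C)))) : BondConfig V) ∅ + 4 =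
        clusterCount (↑(γ ∪ C) : BondConfig V) ∅ + clusterCount (↑(insert z N \ γ ∪ C) : BondConfig V) ∅ := by clear * - a4 b11; omega
    have e5 : clusterCount (↑(insert s(p₁, c₁) (insert s(c₁, q₁) (γ ∪ C))) : BondConfig V) ∅ + clusterCount (↑(insert s(p₂, c₂) (insert s(c₂, q₂) (insert z N \ γ ∪ C))) : BondConfig V) ∅ + 4 =
        clusterCount (↑(γ ∪ C) : BondConfig V) ∅ + clusterCount (↑(insert z N \ γ ∪ C) : BondConfig V) ∅ + 1 := by clear * - a5 b10; omega
    have e6 : clusterCount (↑(insert s(p₁, c₁) (insert s(p₂, c₂) (γ ∪ C))) : BondConfig V) ∅ + clusterCount (↑(insert s(c₁, q₁) (insert s(c₂, q₂) (insert z N \ γ ∪ C))) : BondConfig V) ∅ + 4 =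
        clusterCount (↑(γ ∪ C) : BondConfig V) ∅ + clusterCount (↑(insert z N \ γ ∪ C) : BondConfig V) ∅ := by clear * - a6 b9; omega
    have e7 : clusterCount (↑(insert s(p₁, c₁) (insert s(c₂, q₂) (γ ∪ C))) : BondConfig V) ∅ + clusterCount (↑(insert s(c₁, q₁) (insert s(p₂, c₂) (insert z N \ γ ∪ C))) : BondConfig V) ∅ + 4 =
        clusterCount (↑(γ ∪ C) : BondConfig V) ∅ + clusterCount (↑(insert z N \ γ ∪ C) : BondConfig V) ∅ := by clear * - a7 b8; omega
    have e8 : clusterCount (↑(insert s(c₁, q₁) (insert s(p₂, c₂) (γ ∪ C))) : BondConfig V) ∅ + clusterCount (↑(insert s(p₁, c₁) (insert s(c₂, q₂) (insert z N \ γ ∪ C))) : BondConfig V) ∅ + 4 =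
        clusterCount (↑(γ ∪ C) : BondConfig V) ∅ + clusterCount (↑(insert z N \ γ ∪ C) : BondConfig V) ∅ := by clear * - a8 b7; omega
    have e9 : clusterCount (↑(insert s(c₁, q₁) (insert s(c₂, q₂) (γ ∪ C))) : BondConfig V) ∅ + clusterCount (↑(insert s(p₁, c₁) (insert s(p₂, c₂) (insert z N \ γ ∪ C))) : BondConfig V) ∅ + 4 =
        clusterCount (↑(γ ∪ C) : BondConfig V) ∅ + clusterCount (↑(insert z N \ γ ∪ C) : BondConfig V) ∅ := by clear * - a9 b6; omega
    have e10 : clusterCount (↑(insert s(p₂, c₂) (insert s(c₂, q₂) (γ ∪ C))) : BondConfig V) ∅ + clusterCount (↑(insert s(p₁, c₁) (insert s(c₁, q₁) (insert z N \ γ ∪ C))) : BondConfig V) ∅ + 4 =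
        clusterCount (↑(γ ∪ C) : BondConfig V) ∅ + clusterCount (↑(insert z N \ γ ∪ C) : BondConfig V) ∅ + 1 := by clear * - a10 b5; omega
    have e11 : clusterCount (↑(insert s(p₁, c₁) (insert s(c₁, q₁) (insert s(p₂, c₂) (γ ∪ C)))) : BondConfig V) ∅ + clusterCount (↑(insert s(c₂, q₂) (insert z N \ γ ∪ C)) : BondConfig V) ∅ + 4 =
        clusterCount (↑(γ ∪ C) : BondConfig V) ∅ + clusterCount (↑(insert z N \ γ ∪ C) : BondConfig V) ∅ + 1 := by clear * - a11 b4; omega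
    have e12 : clusterCount (↑(insert s(p₁, c₁) (insert s(c₁, q₁) (insert s(c₂, q₂) (γ ∪ C)))) : BondConfig V) ∅ + clusterCount (↑(insert s(p₂, c₂) (insert z N \ γ ∪ C)) : BondConfig V) ∅ + 4 =
        clusterCount (↑(γ ∪ C) : BondConfig V) ∅ + clusterCount (↑(insert z N \ γ ∪ C) : BondConfig V) ∅ + 1 := by clear * - a12 b3; omega
    have e13 : clusterCount (↑(insert s(p₁, c₁) (insert s(p₂, c₂) (insert s(c₂, q₂) (γ ∪ C)))) : BondConfig V) ∅ + clusterCount (↑(insert s(c₁, q₁) (insert z N \ γ ∪ C)) : BondConfig V) ∅ + 4 =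
        clusterCount (↑(γ ∪ C) : BondConfig V) ∅ + clusterCount (↑(insert z N \ γ ∪ C) : BondConfig V) ∅ + 1 := by clear * - a13 b2; omega
    have e14 : clusterCount (↑(insert s(c₁, q₁) (insert s(p₂, c₂) (insert s(c₂, q₂) (γ ∪ C)))) : BondConfig V) ∅ + clusterCount (↑(insert s(p₁, c₁) (insert z N \ γ ∪ C)) : BondConfig V) ∅ + 4 =
        clusterCount (↑(γ ∪ C) : BondConfig V) ∅ + clusterCount (↑(insert z N \ γ ∪ C) : BondConfig V) ∅ + 1 := by clear * - a14 b1; omega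
    have e15 : clusterCount (↑(insert s(p₁, c₁) (insert s(c₁, q₁) (insert s(p₂, c₂) (insert s(c₂, q₂) (γ ∪ C))))) : BondConfig V) ∅ + clusterCount (↑(insert z N \ γ ∪ C) : BondConfig V) ∅ + 4 =
        clusterCount (↑(γ ∪ C) : BondConfig V) ∅ + clusterCount (↑(insert z N \ γ ∪ C) : BondConfig V) ∅ + 1 + 1 := by clear * - a15; omega
    rw [e0, e1, e2, e3, e4, e5, e6, e7, e8, e9, e10, e11, e12, e13, e14, e15]
    by_cases hz : z ∈ γ
    · simp only [hz, if_true, not_true, if_false]; ring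
    · simp only [hz, if_false, not_false_iff, if_true]; ring
  · have e0 : clusterCount (↑(γ ∪ C) : BondConfig V) ∅ + clusterCount (↑(insert s(p₁, c₁) (insert s(c₁, q₁) (insert s(p₂, c₂) (insert s(c₂, q₂) (insert z N \ γ ∪ C))))) : BondConfig V) ∅ + 4 =
        clusterCount (↑(γ ∪ C) : BondConfig V) ∅ + clusterCount (↑(insert z N \ γ ∪ C) : BondConfig V) ∅ + 1 + 1 := by clear * - b15; omega
    have e1 : clusterCount (↑(insert s(p₁, c₁) (γ ∪ C)) : BondConfig V) ∅ + clusterCount (↑(insert s(c₁, q₁) (insert s(p₂, c₂) (insert s(c₂, q₂) (insert z N \ γ ∪ C)))) : BondConfig V) ∅ + 4 =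
        clusterCount (↑(γ ∪ C) : BondConfig V) ∅ + clusterCount (↑(insert z N \ γ ∪ C) : BondConfig V) ∅ + 1 := by clear * - a1 b14; omega
    have e2 : clusterCount (↑(insert s(c₁, q₁) (γ ∪ C)) : BondConfig V) ∅ + clusterCount (↑(insert s(p₁, c₁) (insert s(p₂, c₂) (insert s(c₂, q₂) (insert z N \ γ ∪ C)))) : BondConfig V) ∅ + 4 =
        clusterCount (↑(γ ∪ C) : BondConfig V) ∅ + clusterCount (↑(insert z N \ γ ∪ C) : BondConfig V) ∅ + 1 := by clear * - a2 b13; omega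
    have e3 : clusterCount (↑(insert s(p₂, c₂) (γ ∪ C)) : BondConfig V) ∅ + clusterCount (↑(insert s(p₁, c₁) (insert s(c₁, q₁) (insert s(c₂, q₂) (insert z N \ γ ∪ C)))) : BondConfig V) ∅ + 4 =
        clusterCount (↑(γ ∪ C) : BondConfig V) ∅ + clusterCount (↑(insert z N \ γ ∪ C) : BondConfig V) ∅ + 1 := by clear * - a3 b12; omega
    have e4 : clusterCount (↑(insert s(c₂, q₂) (γ ∪ C)) : BondConfig V) ∅ + clusterCount (↑(insert s(p₁, c₁) (insert s(c₁, q₁) (insert s(p₂, c₂) (insert z N \ γ ∪ C)))) : BondConfig V) ∅ + 4 =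
        clusterCount (↑(γ ∪ C) : BondConfig V) ∅ + clusterCount (↑(insert z N \ γ ∪ C) : BondConfig V) ∅ + 1 := by clear * - a4 b11; omega
    have e5 : clusterCount (↑(insert s(p₁, c₁) (insert s(c₁, q₁) (γ ∪ C))) : BondConfig V) ∅ + clusterCount (↑(insert s(p₂, c₂) (insert s(c₂, q₂) (insert z N \ γ ∪ C))) : BondConfig V) ∅ + 4 =
        clusterCount (↑(γ ∪ C) : BondConfig V) ∅ + clusterCount (↑(insert z N \ γ ∪ C) : BondConfig V) ∅ + 1 := by clear * - a5 b10; omega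
    have e6 : clusterCount (↑(insert s(p₁, c₁) (insert s(p₂, c₂) (γ ∪ C))) : BondConfig V) ∅ + clusterCount (↑(insert s(c₁, q₁) (insert s(c₂, q₂) (insert z N \ γ ∪ C))) : BondConfig V) ∅ + 4 =
        clusterCount (↑(γ ∪ C) : BondConfig V) ∅ + clusterCount (↑(insert z N \ γ ∪ C) : BondConfig V) ∅ := by clear * - a6 b9; omega
    have e7 : clusterCount (↑(insert s(p₁, c₁) (insert s(c₂, q₂) (γ ∪ C))) : BondConfig V) ∅ + clusterCount (↑(insert s(c₁, q₁) (insert s(p₂, c₂) (insert z N \ γ ∪ C))) : BondConfig V) ∅ + 4 =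
        clusterCount (↑(γ ∪ C) : BondConfig V) ∅ + clusterCount (↑(insert z N \ γ ∪ C) : BondConfig V) ∅ := by clear * - a7 b8; omega
    have e8 : clusterCount (↑(insert s(c₁, q₁) (insert s(p₂, c₂) (γ ∪ C))) : BondConfig V) ∅ + clusterCount (↑(insert s(p₁, c₁) (insert s(c₂, q₂) (insert z N \ γ ∪ C))) : BondConfig V) ∅ + 4 =
        clusterCount (↑(γ ∪ C) : BondConfig V) ∅ + clusterCount (↑(insert z N \ γ ∪ C) : BondConfig V) ∅ := by clear * - a8 b7; omega
    have e9 : clusterCount (↑(insert s(c₁, q₁) (insert s(c₂, q₂) (γ ∪ C))) : BondConfig V) ∅ + clusterCount (↑(insert s(p₁, c₁) (insert s(p₂, c₂) (insert z N \ γ ∪ C))) : BondConfig V) ∅ + 4 =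
        clusterCount (↑(γ ∪ C) : BondConfig V) ∅ + clusterCount (↑(insert z N \ γ ∪ C) : BondConfig V) ∅ := by clear * - a9 b6; omega
    have e10 : clusterCount (↑(insert s(p₂, c₂) (insert s(c₂, q₂) (γ ∪ C))) : BondConfig V) ∅ + clusterCount (↑(insert s(p₁, c₁) (insert s(c₁, q₁) (insert z N \ γ ∪ C))) : BondConfig V) ∅ + 4 =
        clusterCount (↑(γ ∪ C) : BondConfig V) ∅ + clusterCount (↑(insert z N \ γ ∪ C) : BondConfig V) ∅ + 1 := by clear * - a10 b5; omega
    have e11 : clusterCount (↑(insert s(p₁, c₁) (insert s(c₁, q₁) (insert s(p₂, c₂) (γ ∪ C)))) : BondConfig V) ∅ + clusterCount (↑(insert s(c₂, q₂) (insert z N \ γ ∪ C)) : BondConfig V) ∅ + 4 =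
        clusterCount (↑(γ ∪ C) : BondConfig V) ∅ + clusterCount (↑(insert z N \ γ ∪ C) : BondConfig V) ∅ := by clear * - a11 b4; omega
    have e12 : clusterCount (↑(insert s(p₁, c₁) (insert s(c₁, q₁) (insert s(c₂, q₂) (γ ∪ C)))) : BondConfig V) ∅ + clusterCount (↑(insert s(p₂, c₂) (insert z N \ γ ∪ C)) : BondConfig V) ∅ + 4 =
        clusterCount (↑(γ ∪ C) : BondConfig V) ∅ + clusterCount (↑(insert z N \ γ ∪ C) : BondConfig V) ∅ := by clear * - a12 b3; omega
    have e13 : clusterCount (↑(insert s(p₁, c₁) (insert s(p₂, c₂) (insert s(c₂, q₂) (γ ∪ C)))) : BondConfig V) ∅ + clusterCount (↑(insert s(c₁, q₁) (insert z N \ γ ∪ C)) : BondConfig V) ∅ + 4 =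
        clusterCount (↑(γ ∪ C) : BondConfig V) ∅ + clusterCount (↑(insert z N \ γ ∪ C) : BondConfig V) ∅ := by clear * - a13 b2; omega
    have e14 : clusterCount (↑(insert s(c₁, q₁) (insert s(p₂, c₂) (insert s(c₂, q₂) (γ ∪ C)))) : BondConfig V) ∅ + clusterCount (↑(insert s(p₁, c₁) (insert z N \ γ ∪ C)) : BondConfig V) ∅ + 4 =
        clusterCount (↑(γ ∪ C) : BondConfig V) ∅ + clusterCount (↑(insert z N \ γ ∪ C) : BondConfig V) ∅ := by clear * - a14 b1; omega
    have e15 : clusterCount (↑(insert s(p₁, c₁) (insert s(c₁, q₁) (insert s(p₂, c₂) (insert s(c₂, q₂) (γ ∪ C))))) : BondConfig V) ∅ + clusterCount (↑(insert z N \ γ ∪ C) : BondConfig V) ∅ + 4 =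
        clusterCount (↑(γ ∪ C) : BondConfig V) ∅ + clusterCount (↑(insert z N \ γ ∪ C) : BondConfig V) ∅ + 1 := by clear * - a15; omega
    rw [e0, e1, e2, e3, e4, e5, e6, e7, e8, e9, e10, e11, e12, e13, e14, e15]
    by_cases hz : z ∈ γ
    · simp only [hz, if_true, not_true, if_false]; ring
    · simp only [hz, if_false, not_false_iff, if_true]; ring
  · have e0 : clusterCount (↑(γ ∪ C) : BondConfig V) ∅ + clusterCount (↑(insert s(p₁, c₁) (insert s(c₁, q₁) (insert s(p₂, c₂) (insert s(c₂, q₂) (insert z N \ γ ∪ C))))) : BondConfig V) ∅ + 4 =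
        clusterCount (↑(γ ∪ C) : BondConfig V) ∅ + clusterCount (↑(insert z N \ γ ∪ C) : BondConfig V) ∅ + 1 := by clear * - b15; omega
    have e1 : clusterCount (↑(insert s(p₁, c₁) (γ ∪ C)) : BondConfig V) ∅ + clusterCount (↑(insert s(c₁, q₁) (insert s(p₂, c₂) (insert s(c₂, q₂) (insert z N \ γ ∪ C)))) : BondConfig V) ∅ + 4 =
        clusterCount (↑(γ ∪ C) : BondConfig V) ∅ + clusterCount (↑(insert z N \ γ ∪ C) : BondConfig V) ∅ := by clear * - a1 b14; omega
    have e2 : clusterCount (↑(insert s(c₁, q₁) (γ ∪ C)) : BondConfig V) ∅ + clusterCount (↑(insert s(p₁, c₁) (insert s(p₂, c₂) (insert s(c₂, q₂) (insert z N \ γ ∪ C)))) : BondConfig V) ∅ + 4 =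
        clusterCount (↑(γ ∪ C) : BondConfig V) ∅ + clusterCount (↑(insert z N \ γ ∪ C) : BondConfig V) ∅ := by clear * - a2 b13; omega
    have e3 : clusterCount (↑(insert s(p₂, c₂) (γ ∪ C)) : BondConfig V) ∅ + clusterCount (↑(insert s(p₁, c₁) (insert s(c₁, q₁) (insert s(c₂, q₂) (insert z N \ γ ∪ C)))) : BondConfig V) ∅ + 4 =
        clusterCount (↑(γ ∪ C) : BondConfig V) ∅ + clusterCount (↑(insert z N \ γ ∪ C) : BondConfig V) ∅ := by clear * - a3 b12; omega
    have e4 : clusterCount (↑(insert s(c₂, q₂) (γ ∪ C)) : BondConfig V) ∅ + clusterCount (↑(insert s(p₁, c₁) (insert s(c₁, q₁) (insert s(p₂, c₂) (insert z N \ γ ∪ C)))) : BondConfig V) ∅ + 4 =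
        clusterCount (↑(γ ∪ C) : BondConfig V) ∅ + clusterCount (↑(insert z N \ γ ∪ C) : BondConfig V) ∅ := by clear * - a4 b11; omega
    have e5 : clusterCount (↑(insert s(p₁, c₁) (insert s(c₁, q₁) (γ ∪ C))) : BondConfig V) ∅ + clusterCount (↑(insert s(p₂, c₂) (insert s(c₂, q₂) (insert z N \ γ ∪ C))) : BondConfig V) ∅ + 4 =
        clusterCount (↑(γ ∪ C) : BondConfig V) ∅ + clusterCount (↑(insert z N \ γ ∪ C) : BondConfig V) ∅ := by clear * - a5 b10; omega
    have e6 : clusterCount (↑(insert s(p₁, c₁) (insert s(p₂, c₂) (γ ∪ C))) : BondConfig V) ∅ + clusterCount (↑(insert s(c₁, q₁) (insert s(c₂, q₂) (insert z N \ γ ∪ C))) : BondConfig V) ∅ + 4 =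
        clusterCount (↑(γ ∪ C) : BondConfig V) ∅ + clusterCount (↑(insert z N \ γ ∪ C) : BondConfig V) ∅ := by clear * - a6 b9; omega
    have e7 : clusterCount (↑(insert s(p₁, c₁) (insert s(c₂, q₂) (γ ∪ C))) : BondConfig V) ∅ + clusterCount (↑(insert s(c₁, q₁) (insert s(p₂, c₂) (insert z N \ γ ∪ C))) : BondConfig V) ∅ + 4 =
        clusterCount (↑(γ ∪ C) : BondConfig V) ∅ + clusterCount (↑(insert z N \ γ ∪ C) : BondConfig V) ∅ := by clear * - a7 b8; omega
    have e8 : clusterCount (↑(insert s(c₁, q₁) (insert s(p₂, c₂) (γ ∪ C))) : BondConfig V) ∅ + clusterCount (↑(insert s(p₁, c₁) (insert s(c₂, q₂) (insert z N \ γ ∪ C))) : BondConfig V) ∅ + 4 =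
        clusterCount (↑(γ ∪ C) : BondConfig V) ∅ + clusterCount (↑(insert z N \ γ ∪ C) : BondConfig V) ∅ := by clear * - a8 b7; omega
    have e9 : clusterCount (↑(insert s(c₁, q₁) (insert s(c₂, q₂) (γ ∪ C))) : BondConfig V) ∅ + clusterCount (↑(insert s(p₁, c₁) (insert s(p₂, c₂) (insert z N \ γ ∪ C))) : BondConfig V) ∅ + 4 =
        clusterCount (↑(γ ∪ C) : BondConfig V) ∅ + clusterCount (↑(insert z N \ γ ∪ C) : BondConfig V) ∅ := by clear * - a9 b6; omega
    have e10 : clusterCount (↑(insert s(p₂, c₂) (insert s(c₂, q₂) (γ ∪ C))) : BondConfig V) ∅ + clusterCount (↑(insert s(p₁, c₁) (insert s(c₁, q₁) (insert z N \ γ ∪ C))) : BondConfig V) ∅ + 4 =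
        clusterCount (↑(γ ∪ C) : BondConfig V) ∅ + clusterCount (↑(insert z N \ γ ∪ C) : BondConfig V) ∅ := by clear * - a10 b5; omega
    have e11 : clusterCount (↑(insert s(p₁, c₁) (insert s(c₁, q₁) (insert s(p₂, c₂) (γ ∪ C)))) : BondConfig V) ∅ + clusterCount (↑(insert s(c₂, q₂) (insert z N \ γ ∪ C)) : BondConfig V) ∅ + 4 =
        clusterCount (↑(γ ∪ C) : BondConfig V) ∅ + clusterCount (↑(insert z N \ γ ∪ C) : BondConfig V) ∅ := by clear * - a11 b4; omega
    have e12 : clusterCount (↑(insert s(p₁, c₁) (insert s(c₁, q₁) (insert s(c₂, q₂) (γ ∪ C)))) : BondConfig V) ∅ + clusterCount (↑(insert s(p₂, c₂) (insert z N \ γ ∪ C)) : BondConfig V) ∅ + 4 =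
        clusterCount (↑(γ ∪ C) : BondConfig V) ∅ + clusterCount (↑(insert z N \ γ ∪ C) : BondConfig V) ∅ := by clear * - a12 b3; omega
    have e13 : clusterCount (↑(insert s(p₁, c₁) (insert s(p₂, c₂) (insert s(c₂, q₂) (γ ∪ C)))) : BondConfig V) ∅ + clusterCount (↑(insert s(c₁, q₁) (insert z N \ γ ∪ C)) : BondConfig V) ∅ + 4 =
        clusterCount (↑(γ ∪ C) : BondConfig V) ∅ + clusterCount (↑(insert z N \ γ ∪ C) : BondConfig V) ∅ := by clear * - a13 b2; omega
    have e14 : clusterCount (↑(insert s(c₁, q₁) (insert s(p₂, c₂) (insert s(c₂, q₂) (γ ∪ C)))) : BondConfig V) ∅ + clusterCount (↑(insert s(p₁, c₁) (insert z N \ γ ∪ C)) : BondConfig V) ∅ + 4 =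
        clusterCount (↑(γ ∪ C) : BondConfig V) ∅ + clusterCount (↑(insert z N \ γ ∪ C) : BondConfig V) ∅ := by clear * - a14 b1; omega
    have e15 : clusterCount (↑(insert s(p₁, c₁) (insert s(c₁, q₁) (insert s(p₂, c₂) (insert s(c₂, q₂) (γ ∪ C))))) : BondConfig V) ∅ + clusterCount (↑(insert z N \ γ ∪ C) : BondConfig V) ∅ + 4 =
        clusterCount (↑(γ ∪ C) : BondConfig V) ∅ + clusterCount (↑(insert z N \ γ ∪ C) : BondConfig V) ∅ + 1 := by clear * - a15; omega
    rw [e0, e1, e2, e3, e4, e5, e6, e7, e8, e9, e10, e11, e12, e13, e14, e15]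
    by_cases hz : z ∈ γ
    · simp only [hz, if_true, not_true, if_false]; ring
    · simp only [hz, if_false, not_false_iff, if_true]; ring

end Bridge
end FK

end Summit.CriticalPhenomena.PercolationContinuityZ3.Theorems

end
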